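import Literature.MathematicalPhysics.QuantumFieldTheory.Balaban1983to89.B13Lemma1Torus

/-!
# `Balaban1983to89.B13Lemma1TorusFull` — T. Bałaban, *Renormalization group approach to lattice gauge field theories.
II. Cluster expansions*, Commun. Math. Phys. **116** (1988) 1–22, doi:10.1007/bf01239022 [Balaban1988RG2Cluster]:
**Lemma 1 (1.33)–(1.36) p. 9 on the two-scale TORUS model from the PER-TERM inputs of BOTH term types** — the
(I.3.7)-type chain of `B13Lemma1Eq130` ((1.30), (1.31), (1.32) and the p. 9 sums) carried onto the papers' periodic
carrier `B13Lemma3Torus.TwoTorusStep 4 L N′` with its geometric input G1′ (d_k(Y) ≤ d_k(X₀) + 4M⁻⁴|Y∖X₀|) PROVED by the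
torus adjoining inequality and the □-count PROVED in the repaired form of `B13Lemma1Torus.card_le_mul_exp_torus`
(cell GAPS G-B13-07), then knitted with `B13Lemma1Torus.lemma1Printed_twoTorus`

statement-level skeleton of published theorems with citation tags; proofs where landed; nothing here is a claim about
the Yang–Mills mass gap

PDF held: `paper:balaban1988-cmp116-rg-ii-cluster` (journal page = PDF page + 0); pp. 8–9 re-read this session as images
and from the text layer; (1.30)–(1.32) and the p. 9 paragraph are quoted verbatim in `B13Lemma1Eq130`.

CITATION HEADER / WHAT IS REPRODUCED (cell `pub-ymgap`, Track A node N10 = [B13], prover seat `pub-ymgap-dag-p2`, fourth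
module; NEW LEAF over `B13Lemma1Torus` (p403902); sibling of `B13Lemma1Eq130` (p403609), whose abstract chain it re-runs
with the □-count left free (that module is not imported); nothing in either is modified.  p. 9 [PDF 9], verbatim:
*"Finally, the sum over all possible cubes □ can be bounded by M⁻⁴|Y| ≤ 3·2³d_k(Y) ≤ exp δκd_k(Y). These estimates
yield again a bound of the form (1.29) for the considered sum, with the last exponential replaced by
exp(−(1 − 2δ)κd_k(Y))."*
* §1 `gather_p9_count` — the p. 9 nested-sum bookkeeping of `B13Lemma1Eq130.gather_p9` with the □-count left as a
  bare number `#{□} ≤ Cnt` (scalars; conclusion `2K′O(1)O₂·Cnt·exp(−(1 − δ)κd_k(Y))`), so that EITHER the printed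
  count `Cnt = exp δκd_k(Y)` OR the repaired count `Cnt = 4·2^d·exp δκd_k(Y)` can be inserted — the printed middle term
  `3·2³d_k(Y)` fails for degenerate Y (cell GAPS G-B13-07) and the (I.3.7)-type domains Y = X₀ ∪ (decoupled cubes) CAN
  be degenerate (X₀ one M-cube plus one adjacent cube: d_k(Y) = 0, two cubes □ ⊂ Y), so on a concrete carrier only the
  repaired count is a theorem; the price is the absolute factor 4·2^d = 64 in the prefactor P₂.
* §1b `ineq131_torus` — **(1.31) PROVED on the torus tower**: X on the scale-j torus (L^{k−j}·N cubes per direction),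
  X₀ := the π_k-blocks met by X (`isTDom_image_tcoarse`): d_k(X₀) ≤ L^jη·d_j(X) by the exact coarsening
  `TreeLengthTorusTransfer.mul_torusTreeLen_image_le` — the per-term content of the hypothesis `h131` below.
* §2 `boundP9_twoTorus` — **the (I.3.7)-type Y-sum on the torus**: for `W : TwoTorusStep 4 L N′`, from the per-term
  bound (1.30) VERBATIM and (1.31) per term (hypotheses, by reference in print), with X₀ ⊆ Y given as torus
  localization domains (`X0`, `hX0`) and M⁻⁴|Y∖X₀| ≥ #(Y∖X₀) (`hn`): G1′ by `B13Lemma1Torus.g1_torus`, (1.32) by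
  `B13Sect1Arith.bound_132`, the count by `card_le_mul_exp_torus` (δκ ≥ 1, #{□ ⊂ Y} ≤ M⁻⁴|Y|), the level sums as in
  `gather_p9` ⇒ ‖W₂(Y)φ‖ ≤ 2·(64K′)·O(1)·O₂·exp(−(1 − 2δ)κd_k(Y)) on the space (1.34).
* §3 `lemma1Printed_twoTorus_full` — **LEMMA 1 ON THE TORUS FROM PER-TERM INPUTS ONLY**: `B13.Lemma1Printed
  W.toStepData c` from (1.24) per term [(I.3.34)/(I.3.21) type] and (1.30)–(1.31) per term [(I.3.7) type], per-term
  analyticity + closure of `W.Analytic` under finite sums, the printed counts at the scales j ≤ k («8·12³», (1.26) —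
  a torus THEOREM per scale, `TreeLengthTorus.ineq126_torus` —, «(6L)⁴L^jη», the □′-sum O₂), the thresholds
  (κ₁ ≥ 1 + 2 log(8·12³), κ₁ ≥ 2 + 16 log 128, δ₀M ≥ 2/e, δκ ≥ 1, L ≥ 2), R8, R9 and the choice of the constants
  of (1.36); EVERY scale-k geometric input (G1, G1′, (1.27), outer (1.28), the □-count) being a theorem of the torus.
HONEST FRAMING: a count-neutral Track-A side landing (YM-PLAN §1); NOT a discharge of node N10 (B13 group FREE at
NODE 00 Stages 1–2); one finite T⁴ programme at fixed ε; nothing continuum / OS / mass-gap / Clay.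
-/

noncomputable section

namespace Literature.MathematicalPhysics.QuantumFieldTheory.Balaban1983to89.B13Lemma1TorusFull

open Literature.MathematicalPhysics.QuantumFieldTheory.Balaban1983to89
open Literature.MathematicalPhysics.QuantumFieldTheory.Balaban1983to89.TreeLengthTorus
open Literature.MathematicalPhysics.QuantumFieldTheory.Balaban1983to89.B13Lemma3Torus (TwoTorusStep)
open Literature.MathematicalPhysics.QuantumFieldTheory.Balaban1983to89.B13Lemma1Torus
  (g1_torus card_le_mul_exp_torus lemma1Printed_twoTorus)

/-- Closure of an abstract analyticity predicate under `Finset` sums (the silent step of p. 9).  Private kernel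
plumbing. [folklore] -/
private theorem analytic_finset_sum {Φ : Type*} (An : (Φ → ℂ) → Set Φ → Prop) (s : Set Φ)
    (hAdd : ∀ f g, An f s → An g s → An (f + g) s) (hZero : An 0 s) {ι : Type*} (I : Finset ι)
    (f : ι → Φ → ℂ) (h : ∀ i ∈ I, An (f i) s) : An (∑ i ∈ I, f i) s :=
  Finset.sum_induction f (fun g => An g s) (fun a b ha hb => hAdd a b ha hb) hZero h

/-- The geometric j-sum Σ_{j ≤ k} L^{j−k} ≤ 2 for L ≥ 2 (= `B13Lemma1Eq130.jsum_le_two`; re-derived here from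
`B13Sect1Arith.jsum_le` to keep this leaf's imports to built modules).  Private kernel plumbing. [folklore] -/
private theorem jsum_le_two' {L : ℝ} (hL : 2 ≤ L) (k : ℕ) :
    ∑ j ∈ Finset.range (k + 1), L ^ j * (L ^ k)⁻¹ ≤ 2 := by
  have h := B13Sect1Arith.jsum_le hL k
  rw [← Finset.mul_sum] at h
  have hpos : (0 : ℝ) < (6 * L) ^ 4 := by positivity
  nlinarith

/-! ## §1. The p. 9 bookkeeping with the □-count as a bare number -/

/-- **p. 9 nested-sum bookkeeping with the □-count left free** (scalars; cf. `B13Lemma1Eq130.gather_p9`, which is the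
case `Cnt = exp δκd_k(Y)`): terms bounded by the (1.30) prefactor × first exponential × the (1.32)-form of the last two
exponentials (`hT`), the X-sum by (1.26) at the rate δκ (`hX`), the □′-sum ≤ O₂ (`hq`), the factor L^jη
(`B13Sect1Arith.factor_Ljη`, δ₀M ≥ 2e⁻¹) and Σ_j L^jη ≤ 2 (`B13Sect1Arith.jsum_le`) PROVED, and `#{□} ≤ Cnt`
(`hc`) ⇒ the whole sum ≤ 2K′O(1)O₂·Cnt·exp(−(1 − δ)κd_k(Y)). [cite: Balaban1988RG2Cluster, p.9 (before Lemma 1)] -/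
theorem gather_p9_count {α γ δ : Type*} (Sc : Finset α) (k : ℕ) (Sq : α → ℕ → Finset γ)
    (SX : α → ℕ → γ → Finset δ) (T : α → ℕ → γ → δ → ℝ) (dist : α → ℕ → γ → ℝ) (dj : α → ℕ → γ → δ → ℝ)
    {K' O1 O₂ L δ₀ M δ κ d Cnt : ℝ} (hK' : 0 ≤ K') (hO1 : 0 ≤ O1) (hO₂ : 0 ≤ O₂) (hL : 2 ≤ L)
    (ha : 2 * Real.exp (-1) ≤ δ₀ * M)
    (hT : ∀ c ∈ Sc, ∀ j ∈ Finset.range (k + 1), ∀ q ∈ Sq c j, ∀ x ∈ SX c j q,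
      T c j q x ≤ K' * Real.exp (-(1 / 2) * (δ₀ * M) * (L ^ j * (L ^ k)⁻¹)⁻¹ - (1 / 2) * δ₀ * dist c j q) *
        Real.exp (-(1 - δ) * κ * d - δ * κ * dj c j q x))
    (hX : ∀ c ∈ Sc, ∀ j ∈ Finset.range (k + 1), ∀ q ∈ Sq c j,
      ∑ x ∈ SX c j q, Real.exp (-(δ * κ * dj c j q x)) ≤ O1)
    (hq : ∀ c ∈ Sc, ∀ j ∈ Finset.range (k + 1), ∑ q ∈ Sq c j, Real.exp (-((1 / 2) * δ₀ * dist c j q)) ≤ O₂)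
    (hc : (Sc.card : ℝ) ≤ Cnt) :
    ∑ c ∈ Sc, ∑ j ∈ Finset.range (k + 1), ∑ q ∈ Sq c j, ∑ x ∈ SX c j q, T c j q x
      ≤ 2 * K' * O1 * O₂ * Cnt * Real.exp (-(1 - δ) * κ * d) := by
  set ℓ : ℕ → ℝ := fun j => L ^ j * (L ^ k)⁻¹
  have hL0 : 0 < L := by linarith
  have hℓpos : ∀ j, 0 < ℓ j := fun j => by positivity
  set A := Real.exp (-(1 - δ) * κ * d) with hA
  have hsplit : ∀ c j q x,
      K' * Real.exp (-(1 / 2) * (δ₀ * M) * (ℓ j)⁻¹ - (1 / 2) * δ₀ * dist c j q) *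
          Real.exp (-(1 - δ) * κ * d - δ * κ * dj c j q x)
        = K' * A * Real.exp (-(1 / 2) * (δ₀ * M) * (ℓ j)⁻¹) * Real.exp (-((1 / 2) * δ₀ * dist c j q)) *
            Real.exp (-(δ * κ * dj c j q x)) := by
    intro c j q x
    rw [hA]
    have e1 : Real.exp (-(1 / 2) * (δ₀ * M) * (ℓ j)⁻¹ - (1 / 2) * δ₀ * dist c j q)
        = Real.exp (-(1 / 2) * (δ₀ * M) * (ℓ j)⁻¹) * Real.exp (-((1 / 2) * δ₀ * dist c j q)) := by
      rw [← Real.exp_add]; ring_nf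
    have e2 : Real.exp (-(1 - δ) * κ * d - δ * κ * dj c j q x)
        = Real.exp (-(1 - δ) * κ * d) * Real.exp (-(δ * κ * dj c j q x)) := by
      rw [← Real.exp_add]; ring_nf
    rw [e1, e2]; ring
  have hLX : ∀ c ∈ Sc, ∀ j ∈ Finset.range (k + 1), ∀ q ∈ Sq c j,
      ∑ x ∈ SX c j q, T c j q x
        ≤ K' * A * Real.exp (-(1 / 2) * (δ₀ * M) * (ℓ j)⁻¹) * Real.exp (-((1 / 2) * δ₀ * dist c j q)) * O1 := by
    intro c hc' j hj q hq'
    calc ∑ x ∈ SX c j q, T c j q x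
        ≤ ∑ x ∈ SX c j q, K' * A * Real.exp (-(1 / 2) * (δ₀ * M) * (ℓ j)⁻¹) *
            Real.exp (-((1 / 2) * δ₀ * dist c j q)) * Real.exp (-(δ * κ * dj c j q x)) :=
          Finset.sum_le_sum fun x hx => by rw [← hsplit]; exact hT c hc' j hj q hq' x hx
      _ = K' * A * Real.exp (-(1 / 2) * (δ₀ * M) * (ℓ j)⁻¹) * Real.exp (-((1 / 2) * δ₀ * dist c j q)) *
            ∑ x ∈ SX c j q, Real.exp (-(δ * κ * dj c j q x)) := by rw [Finset.mul_sum]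
      _ ≤ _ := mul_le_mul_of_nonneg_left (hX c hc' j hj q hq') (by positivity)
  have hLq : ∀ c ∈ Sc, ∀ j ∈ Finset.range (k + 1),
      ∑ q ∈ Sq c j, ∑ x ∈ SX c j q, T c j q x ≤ K' * A * O1 * O₂ * ℓ j := by
    intro c hc' j hj
    have hfac : Real.exp (-(1 / 2) * (δ₀ * M) * (ℓ j)⁻¹) ≤ ℓ j := B13Sect1Arith.factor_Ljη (hℓpos j) ha
    calc ∑ q ∈ Sq c j, ∑ x ∈ SX c j q, T c j q x
        ≤ ∑ q ∈ Sq c j, K' * A * Real.exp (-(1 / 2) * (δ₀ * M) * (ℓ j)⁻¹) *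
            Real.exp (-((1 / 2) * δ₀ * dist c j q)) * O1 :=
          Finset.sum_le_sum fun q hq' => hLX c hc' j hj q hq'
      _ = K' * A * O1 * Real.exp (-(1 / 2) * (δ₀ * M) * (ℓ j)⁻¹) *
            ∑ q ∈ Sq c j, Real.exp (-((1 / 2) * δ₀ * dist c j q)) := by
          rw [Finset.mul_sum]; refine Finset.sum_congr rfl fun q _ => by ring
      _ ≤ K' * A * O1 * ℓ j * O₂ :=
          mul_le_mul (mul_le_mul_of_nonneg_left hfac (by positivity)) (hq c hc' j hj)
            (Finset.sum_nonneg fun q _ => (Real.exp_pos _).le) (by positivity)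
      _ = K' * A * O1 * O₂ * ℓ j := by ring
  have hLj : ∀ c ∈ Sc,
      ∑ j ∈ Finset.range (k + 1), ∑ q ∈ Sq c j, ∑ x ∈ SX c j q, T c j q x ≤ K' * A * O1 * O₂ * 2 := by
    intro c hc'
    calc ∑ j ∈ Finset.range (k + 1), ∑ q ∈ Sq c j, ∑ x ∈ SX c j q, T c j q x
        ≤ ∑ j ∈ Finset.range (k + 1), K' * A * O1 * O₂ * ℓ j := Finset.sum_le_sum fun j hj => hLq c hc' j hj
      _ = K' * A * O1 * O₂ * ∑ j ∈ Finset.range (k + 1), ℓ j := by rw [Finset.mul_sum]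
      _ ≤ K' * A * O1 * O₂ * 2 :=
          mul_le_mul_of_nonneg_left (jsum_le_two' hL k) (by positivity)
  calc ∑ c ∈ Sc, ∑ j ∈ Finset.range (k + 1), ∑ q ∈ Sq c j, ∑ x ∈ SX c j q, T c j q x
      ≤ Sc.card * (K' * A * O1 * O₂ * 2) := B13Sect1Arith.sum_le_card_mul _ _ _ hLj
    _ ≤ Cnt * (K' * A * O1 * O₂ * 2) := mul_le_mul_of_nonneg_right hc (by positivity)
    _ = 2 * K' * O1 * O₂ * Cnt * A := by ring

/-! ## §1b. The scaling inequality (1.31) on the torus tower -/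

section Scaling

variable {d : ℕ}

/-- X₀ — *"the smallest localization domain from 𝐃_k containing X"* (p. 8) — ON THE TORUS TOWER: for a localization
domain X of the scale-j torus (m·N cubes of π_j per direction, m = L^{k−j}, the π_k-cubes being blocks of m^d
π_j-cubes of the SAME torus, [Balaban1987RG1] p. 251) it is the family of blocks met by X, `X.image (tcoarse m N)`,
again a torus localization domain (`TreeLengthTorusTransfer.tFaceConnected_image_tcoarse`).
[cite: Balaban1988RG2Cluster, p.8 (definition of X₀)] -/
theorem isTDom_image_tcoarse (m N : ℕ) [NeZero m] [NeZero N] {X : Finset (TPt d (m * N))} (hX : IsTDom X) :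
    IsTDom (X.image (TreeLengthTorusTransfer.tcoarse m N)) :=
  ⟨hX.1.image _, TreeLengthTorusTransfer.tFaceConnected_image_tcoarse hX.2⟩

/-- **(1.31) p. 9 ON THE TORUS TOWER** — *"By the definition of the linear size functions they satisfy the following
fundamental scaling inequality d_j(X) ≥ (L^jη)⁻¹d_k(X₀). (1.31)"* — PROVED: with η = L^{−k}, (L^jη)⁻¹ = L^{k−j} = m and
X₀ = the blocks met by X, `d_k(X₀) ≤ L^jη·d_j(X)`, i.e. m·d_k(X₀) ≤ d_j(X) — the exact coarsening
`TreeLengthTorusTransfer.mul_torusTreeLen_image_le` ([Dimock2013] Lemma 10) at the block factor m = L^{k−j}; this is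
the hypothesis `h131` of `boundP9_twoTorus` / `B13Lemma1Eq130.boundP9_of_130` for terms whose X lives on the scale-j
torus. [cite: Balaban1988RG2Cluster, (1.31) p.9] -/
theorem ineq131_torus (L N k j : ℕ) [NeZero L] [NeZero N] (hjk : j ≤ k) {X : Finset (TPt d (L ^ (k - j) * N))}
    (hX : IsTDom X) :
    torusTreeLen (X.image (TreeLengthTorusTransfer.tcoarse (L ^ (k - j)) N)) ≤
      ((L : ℝ) ^ j * ((L : ℝ) ^ k)⁻¹) * torusTreeLen X := by
  have hL0 : (0 : ℝ) < L := by exact_mod_cast Nat.pos_of_ne_zero (NeZero.ne L)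
  have hm : (0 : ℝ) < (L : ℝ) ^ (k - j) := by positivity
  have h := TreeLengthTorusTransfer.mul_torusTreeLen_image_le (L := L ^ (k - j)) (N' := N) hX.1 hX.2
  push_cast at h
  have hkj : (L : ℝ) ^ k = (L : ℝ) ^ j * (L : ℝ) ^ (k - j) := by
    rw [← pow_add, Nat.add_sub_cancel' hjk]
  have e : (L : ℝ) ^ j * ((L : ℝ) ^ k)⁻¹ = ((L : ℝ) ^ (k - j))⁻¹ := by
    rw [hkj, mul_inv, ← mul_assoc, mul_inv_cancel₀ (by positivity), one_mul]
  rw [e, ← div_eq_inv_mul, le_div_iff₀ hm, mul_comm]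
  exact h

end Scaling

/-! ## §2. The (I.3.7)-type Y-sum on the torus -/

section Torus

variable {L N' : ℕ} [NeZero L] [NeZero N']

/-- **The (I.3.7)-type Y-sum ON THE TORUS** (`W : TwoTorusStep 4 L N′`): for the terms `T Y □ j □′ X : Φ → ℂ` of
(1.10) applied to (I.3.15), indexed for fixed Y by □ ∈ `Sc Y` (⊂ Y: `hSc`, #{□} ≤ M⁻⁴|Y|), j ≤ k, □′ ∈ `Sq Y □ j`,
X ∈ `SX Y □ j □′`, each carrying its X₀ = *"the smallest localization domain from 𝐃_k containing X"* as a torus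
localization domain `X0 Y □ j □′ X ⊆ Y` (`hX0`) and n = M⁻⁴|Y∖X₀| ≥ #(Y∖X₀) (`hn`): GIVEN the per-term bound
**(1.30)** VERBATIM on the space (1.34) (`h130`, with d_k(X₀) = `torusTreeLen X₀`) and **(1.31)** per term (`h131`), R8,
0 ≤ κ, δ < 1, δκ ≥ 1, L ≥ 2, δ₀M ≥ 2e⁻¹, (1.26) at the rate δκ (`h126`) and the □′-sum ≤ O₂ (`hq`) — the geometric
input G1′ of (1.32) is `B13Lemma1Torus.g1_torus`, (1.32) is `B13Sect1Arith.bound_132`, the □-count is the REPAIRED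
`B13Lemma1Torus.card_le_mul_exp_torus` (64·e^{δκd_k(Y)}) — the Y-sum satisfies, on `W.sp1 Y`,
`‖(Σ T)(φ)‖ ≤ 2·(64K′)·O(1)·O₂·exp(−(1 − 2δ)κd_k(Y))`: the p. 9 bound *"of the form (1.29) … with the last exponential
replaced by exp(−(1 − 2δ)κd_k(Y))"*, with the honest factor 64 (cell GAPS G-B13-07).
[cite: Balaban1988RG2Cluster, (1.30)–(1.32) pp.8–9] -/
theorem boundP9_twoTorus (W : TwoTorusStep 4 L N') (c : B13.Consts) {α γ δ : Type*}
    (Sc : TDom 4 (L * N') → Finset α) (k : ℕ) (Sq : TDom 4 (L * N') → α → ℕ → Finset γ)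
    (SX : TDom 4 (L * N') → α → ℕ → γ → Finset δ) (T : TDom 4 (L * N') → α → ℕ → γ → δ → W.Φ → ℂ)
    (dist : TDom 4 (L * N') → α → ℕ → γ → ℝ) (dj : TDom 4 (L * N') → α → ℕ → γ → δ → ℝ)
    (X0 : TDom 4 (L * N') → α → ℕ → γ → δ → Finset (TPt 4 (L * N')))
    (n : TDom 4 (L * N') → α → ℕ → γ → δ → ℕ) {K' O1 O₂ : ℝ}
    (hK' : 0 ≤ K') (hO1 : 0 ≤ O1) (hO₂ : 0 ≤ O₂) (hL : 2 ≤ (c.L : ℝ)) (hκ : 0 ≤ c.κ) (hδ1 : c.δ < 1)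
    (hR8 : (1 - c.δ) * c.κ ≤ (1 / 4) * (c.κ₁ - 1)) (hδ₀M : 2 * Real.exp (-1) ≤ c.δ₀ * c.M) (hδκ : 1 ≤ c.δ * c.κ)
    (h130 : ∀ Y φ, φ ∈ W.sp1 Y → ∀ a ∈ Sc Y, ∀ j ∈ Finset.range (k + 1), ∀ q ∈ Sq Y a j, ∀ x ∈ SX Y a j q,
      ‖T Y a j q x φ‖ ≤ K' * Real.exp (-(1 / 2) * (c.δ₀ * c.M) * ((c.L : ℝ) ^ j * ((c.L : ℝ) ^ k)⁻¹)⁻¹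
          - (1 / 2) * c.δ₀ * dist Y a j q) *
        Real.exp (-(c.κ₁ - 1) * (n Y a j q x : ℝ)) * Real.exp (-(c.κ * dj Y a j q x)))
    (hdj : ∀ Y a j q x, 0 ≤ dj Y a j q x)
    (h131 : ∀ Y, ∀ a ∈ Sc Y, ∀ j ∈ Finset.range (k + 1), ∀ q ∈ Sq Y a j, ∀ x ∈ SX Y a j q,
      torusTreeLen (X0 Y a j q x) ≤ ((c.L : ℝ) ^ j * ((c.L : ℝ) ^ k)⁻¹) * dj Y a j q x)
    (hX0 : ∀ Y, ∀ a ∈ Sc Y, ∀ j ∈ Finset.range (k + 1), ∀ q ∈ Sq Y a j, ∀ x ∈ SX Y a j q,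
      X0 Y a j q x ⊆ Y.1 ∧ IsTDom (X0 Y a j q x))
    (hn : ∀ Y, ∀ a ∈ Sc Y, ∀ j ∈ Finset.range (k + 1), ∀ q ∈ Sq Y a j, ∀ x ∈ SX Y a j q,
      (Y.1 \ X0 Y a j q x).card ≤ n Y a j q x)
    (h126 : ∀ Y, ∀ a ∈ Sc Y, ∀ j ∈ Finset.range (k + 1), ∀ q ∈ Sq Y a j,
      ∑ x ∈ SX Y a j q, Real.exp (-(c.δ * c.κ * dj Y a j q x)) ≤ O1)
    (hq : ∀ Y, ∀ a ∈ Sc Y, ∀ j ∈ Finset.range (k + 1),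
      ∑ q ∈ Sq Y a j, Real.exp (-((1 / 2) * c.δ₀ * dist Y a j q)) ≤ O₂)
    (hSc : ∀ Y, (Sc Y).card ≤ Y.1.card) :
    ∀ Y φ, φ ∈ W.sp1 Y →
      ‖(∑ a ∈ Sc Y, ∑ j ∈ Finset.range (k + 1), ∑ q ∈ Sq Y a j, ∑ x ∈ SX Y a j q, T Y a j q x) φ‖
        ≤ 2 * (64 * K') * O1 * O₂ * Real.exp (-(1 - 2 * c.δ) * c.κ * torusTreeLen Y.1) := by
  intro Y φ hφ
  have hL1 : (1 : ℝ) ≤ c.L := by linarith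
  have hLk : (0 : ℝ) < (c.L : ℝ) ^ k := by positivity
  -- (1.30) + G1′ (torus) + (1.31) ⇒ the (1.32)-form per-term bound
  have hT : ∀ a ∈ Sc Y, ∀ j ∈ Finset.range (k + 1), ∀ q ∈ Sq Y a j, ∀ x ∈ SX Y a j q,
      ‖T Y a j q x φ‖ ≤ K' * Real.exp (-(1 / 2) * (c.δ₀ * c.M) * ((c.L : ℝ) ^ j * ((c.L : ℝ) ^ k)⁻¹)⁻¹
          - (1 / 2) * c.δ₀ * dist Y a j q) *
        Real.exp (-(1 - c.δ) * c.κ * torusTreeLen Y.1 - c.δ * c.κ * dj Y a j q x) := by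
    intro a ha j hj q hq' x hx
    have hjk : j ≤ k := Nat.lt_succ_iff.mp (Finset.mem_range.mp hj)
    have hℓ1 : (c.L : ℝ) ^ j * ((c.L : ℝ) ^ k)⁻¹ ≤ 1 := by
      rw [mul_inv_le_iff₀ hLk, one_mul]
      exact pow_le_pow_right₀ hL1 hjk
    obtain ⟨hsub, hdom⟩ := hX0 Y a ha j hj q hq' x hx
    have hG1 : torusTreeLen Y.1 ≤ torusTreeLen (X0 Y a j q x) + 4 * (n Y a j q x : ℝ) :=
      g1_torus hdom Y.2.2 hsub le_rfl (by exact_mod_cast hn Y a ha j hj q hq' x hx)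
    have h132 := B13Sect1Arith.bound_132 (n := (n Y a j q x : ℝ)) hκ hδ1 hR8 hℓ1 (hdj Y a j q x)
      (h131 Y a ha j hj q hq' x hx) (Nat.cast_nonneg _) hG1
    calc ‖T Y a j q x φ‖ ≤ _ := h130 Y φ hφ a ha j hj q hq' x hx
      _ = K' * Real.exp (-(1 / 2) * (c.δ₀ * c.M) * ((c.L : ℝ) ^ j * ((c.L : ℝ) ^ k)⁻¹)⁻¹
            - (1 / 2) * c.δ₀ * dist Y a j q) *
          (Real.exp (-(c.κ₁ - 1) * (n Y a j q x : ℝ)) * Real.exp (-(c.κ * dj Y a j q x))) := by ring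
      _ ≤ _ := mul_le_mul_of_nonneg_left h132 (by positivity)
  -- the repaired □-count on the torus
  have hcnt : ((Sc Y).card : ℝ) ≤ 64 * Real.exp (c.δ * c.κ * torusTreeLen Y.1) := by
    have h := card_le_mul_exp_torus (d := 4) Y.2.1 Y.2.2 hδκ
    have h' : ((Sc Y).card : ℝ) ≤ Y.1.card := by exact_mod_cast hSc Y
    norm_num at h
    linarith
  have hgather := gather_p9_count (Sc Y) k (Sq Y) (SX Y) (fun a j q x => ‖T Y a j q x φ‖) (dist Y) (dj Y)
    (d := torusTreeLen Y.1) hK' hO1 hO₂ hL hδ₀M hT (h126 Y) (hq Y) hcnt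
  have hfinal : 2 * K' * O1 * O₂ * (64 * Real.exp (c.δ * c.κ * torusTreeLen Y.1)) *
      Real.exp (-(1 - c.δ) * c.κ * torusTreeLen Y.1)
        = 2 * (64 * K') * O1 * O₂ * Real.exp (-(1 - 2 * c.δ) * c.κ * torusTreeLen Y.1) := by
    have e : Real.exp (c.δ * c.κ * torusTreeLen Y.1) * Real.exp (-(1 - c.δ) * c.κ * torusTreeLen Y.1)
        = Real.exp (-(1 - 2 * c.δ) * c.κ * torusTreeLen Y.1) := by
      rw [← Real.exp_add]; ring_nf
    calc _ = 2 * (64 * K') * O1 * O₂ * (Real.exp (c.δ * c.κ * torusTreeLen Y.1) *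
          Real.exp (-(1 - c.δ) * c.κ * torusTreeLen Y.1)) := by ring
      _ = _ := by rw [e]
  rw [← hfinal]
  refine le_trans ?_ hgather
  simp only [Finset.sum_apply]
  refine (norm_sum_le _ _).trans (Finset.sum_le_sum fun a _ => ?_)
  refine (norm_sum_le _ _).trans (Finset.sum_le_sum fun j _ => ?_)
  refine (norm_sum_le _ _).trans (Finset.sum_le_sum fun q _ => ?_)
  exact norm_sum_le _ _

/-! ## §3. Lemma 1 on the torus from per-term inputs of both types -/

/-- **LEMMA 1 (1.33)–(1.36) p. 9 ON THE TWO-SCALE TORUS MODEL FROM PER-TERM INPUTS OF BOTH TERM TYPES.**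
`B13.Lemma1Printed W.toStepData c` for `W : TwoTorusStep 4 L N′`, GIVEN ONLY: the decomposition of V′_k(Y) into the
Y-sum of the terms (1.23) [(I.3.34)/(I.3.21) type, indices □₀, Y₀ ↔ W ⊆ F, j, □′, X] plus the Y-sum of the (I.3.7)-type
terms [indices □, j, □′, X] (`h133`); per-term analyticity on (1.34) (p. 7, p. 9) and the closure of `W.Analytic`
under finite sums ([folklore]); the per-term bounds **(1.24)** (`h124`) and **(1.30)** (`h130`) VERBATIM and (1.31)
per term (`h131`) — by reference in print to (I.3.54), (I.3.17), [15] Prop. 4, [13] (3.108); the TORUS DATA of the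
indices (□₀'s block `blk` ⊆ Y with ≥ 80 cubes and d_k ≤ d₀, N ≥ #(Y∖□₀) and ≥ #(Y₀ ∩ (□₀∖□̃⁴)), #{□₀} ≤ M⁻⁴|Y|; X₀ ⊆ Y
a torus localization domain, n ≥ #(Y∖X₀), #{□} ≤ M⁻⁴|Y|); the printed counts at the scales j ≤ k («8·12³», (1.26) at
the rates κ and δκ, «(6L)⁴L^jη», the □′-sum O₂); the thresholds κ₁ ≥ 1 + 2 log(8·12³), κ₁ ≥ 2 + 16 log 128,
δ₀M ≥ 2e⁻¹, δκ ≥ 1, L ≥ 2; R8, R9, 0 ≤ κ, δ < 1; and the choice of the absolute constants of (1.36) with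
P₂ = 2·(64K′)·O(1)·O₂ (`hC`).  ALL scale-k geometry — G1, G1′, (1.25), (1.27), outer (1.28), (1.32), the □-count —
is PROVED (`B13Lemma1Torus`, `B13Sect1Arith`, §2). [cite: Balaban1988RG2Cluster, Lemma 1 pp.7–9] -/
theorem lemma1Printed_twoTorus_full (W : TwoTorusStep 4 L N') (c : B13.Consts) {α γ δ C α' γ' δ' : Type*}
    -- the (I.3.34)/(I.3.21)-type index data
    (S0 : TDom 4 (L * N') → Finset α) (blk : TDom 4 (L * N') → α → Finset (TPt 4 (L * N')))
    (F : TDom 4 (L * N') → α → Finset C) (k : ℕ) (Sq : TDom 4 (L * N') → ℕ → Finset γ)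
    (SX : TDom 4 (L * N') → ℕ → γ → Finset δ) (T : TDom 4 (L * N') → α → Finset C → ℕ → γ → δ → W.Φ → ℂ)
    (dj : TDom 4 (L * N') → ℕ → γ → δ → ℝ) (N : TDom 4 (L * N') → α → Finset C → ℝ)
    -- the (I.3.7)-type index data
    (Sc : TDom 4 (L * N') → Finset α') (Sq' : TDom 4 (L * N') → α' → ℕ → Finset γ')
    (SX' : TDom 4 (L * N') → α' → ℕ → γ' → Finset δ') (T' : TDom 4 (L * N') → α' → ℕ → γ' → δ' → W.Φ → ℂ)
    (dist : TDom 4 (L * N') → α' → ℕ → γ' → ℝ) (dj' : TDom 4 (L * N') → α' → ℕ → γ' → δ' → ℝ)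
    (X0 : TDom 4 (L * N') → α' → ℕ → γ' → δ' → Finset (TPt 4 (L * N')))
    (n : TDom 4 (L * N') → α' → ℕ → γ' → δ' → ℕ) {K O1 d0 K' O1' O₂ : ℝ}
    (h133 : ∀ Y, W.Vp Y = (∑ a ∈ S0 Y, ∑ X ∈ (F Y a).powerset, ∑ j ∈ Finset.range (k + 1), ∑ q ∈ Sq Y j,
      ∑ x ∈ SX Y j q, T Y a X j q x) +
      (∑ a ∈ Sc Y, ∑ j ∈ Finset.range (k + 1), ∑ q ∈ Sq' Y a j, ∑ x ∈ SX' Y a j q, T' Y a j q x))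
    (hAdd : ∀ (s : Set W.Φ) (f g : W.Φ → ℂ), W.Analytic f s → W.Analytic g s → W.Analytic (f + g) s)
    (hZero : ∀ s : Set W.Φ, W.Analytic 0 s)
    (hAnT : ∀ Y, ∀ a ∈ S0 Y, ∀ X ∈ (F Y a).powerset, ∀ j ∈ Finset.range (k + 1), ∀ q ∈ Sq Y j, ∀ x ∈ SX Y j q,
      W.Analytic (T Y a X j q x) (W.sp1 Y))
    (hAnT' : ∀ Y, ∀ a ∈ Sc Y, ∀ j ∈ Finset.range (k + 1), ∀ q ∈ Sq' Y a j, ∀ x ∈ SX' Y a j q,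
      W.Analytic (T' Y a j q x) (W.sp1 Y))
    (hK : 0 ≤ K) (hO1 : 0 ≤ O1) (hd0 : 0 ≤ d0) (hK' : 0 ≤ K') (hO1' : 0 ≤ O1') (hO₂ : 0 ≤ O₂)
    (hL : 2 ≤ (c.L : ℝ)) (hκ : 0 ≤ c.κ) (hδ1 : c.δ < 1) (hδκ : 1 ≤ c.δ * c.κ)
    (hκ₁ : 1 + 2 * Real.log (8 * 12 ^ 3) ≤ c.κ₁) (hκ₁' : 2 + 16 * Real.log 128 ≤ c.κ₁)
    (hδ₀M : 2 * Real.exp (-1) ≤ c.δ₀ * c.M) (hR8 : (1 - c.δ) * c.κ ≤ (1 / 4) * (c.κ₁ - 1))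
    (hR9 : (1 - 2 * c.δ) * c.κ ≤ (1 / 16) * c.κ₁)
    (h124 : ∀ Y φ, φ ∈ W.sp1 Y → ∀ a ∈ S0 Y, ∀ X ∈ (F Y a).powerset, ∀ j ∈ Finset.range (k + 1), ∀ q ∈ Sq Y j,
      ∀ x ∈ SX Y j q, ‖T Y a X j q x φ‖ ≤ K * ((c.L : ℝ) ^ j * ((c.L : ℝ) ^ k)⁻¹) ^ 5 *
        Real.exp (-(c.κ₁ - 1) * N Y a X) * Real.exp (-(c.κ * dj Y j q x)))
    (hblk : ∀ Y, ∀ a ∈ S0 Y, blk Y a ⊆ Y.1 ∧ IsTDom (blk Y a) ∧ torusTreeLen (blk Y a) ≤ d0 ∧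
      (5 : ℝ) * 2 ^ 4 ≤ (blk Y a).card)
    (hNblk : ∀ Y, ∀ a ∈ S0 Y, ∀ X ∈ (F Y a).powerset, ((Y.1 \ blk Y a).card : ℝ) ≤ N Y a X)
    (hN : ∀ Y a, ∀ X ∈ (F Y a).powerset, (X.card : ℝ) ≤ N Y a X)
    (hF : ∀ Y a, ((F Y a).card : ℝ) ≤ 8 * 12 ^ 3)
    (hS0 : ∀ Y, (S0 Y).card ≤ Y.1.card)
    (h126 : ∀ Y, ∀ j ∈ Finset.range (k + 1), ∀ q ∈ Sq Y j,
      ∑ x ∈ SX Y j q, Real.exp (-(c.κ * dj Y j q x)) ≤ O1)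
    (hq : ∀ Y, ∀ j ∈ Finset.range (k + 1),
      ((Sq Y j).card : ℝ) * ((c.L : ℝ) ^ j * ((c.L : ℝ) ^ k)⁻¹) ^ 5 ≤
        (6 * (c.L : ℝ)) ^ 4 * ((c.L : ℝ) ^ j * ((c.L : ℝ) ^ k)⁻¹))
    (h130 : ∀ Y φ, φ ∈ W.sp1 Y → ∀ a ∈ Sc Y, ∀ j ∈ Finset.range (k + 1), ∀ q ∈ Sq' Y a j, ∀ x ∈ SX' Y a j q,
      ‖T' Y a j q x φ‖ ≤ K' * Real.exp (-(1 / 2) * (c.δ₀ * c.M) * ((c.L : ℝ) ^ j * ((c.L : ℝ) ^ k)⁻¹)⁻¹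
          - (1 / 2) * c.δ₀ * dist Y a j q) *
        Real.exp (-(c.κ₁ - 1) * (n Y a j q x : ℝ)) * Real.exp (-(c.κ * dj' Y a j q x)))
    (hdj' : ∀ Y a j q x, 0 ≤ dj' Y a j q x)
    (h131 : ∀ Y, ∀ a ∈ Sc Y, ∀ j ∈ Finset.range (k + 1), ∀ q ∈ Sq' Y a j, ∀ x ∈ SX' Y a j q,
      torusTreeLen (X0 Y a j q x) ≤ ((c.L : ℝ) ^ j * ((c.L : ℝ) ^ k)⁻¹) * dj' Y a j q x)
    (hX0 : ∀ Y, ∀ a ∈ Sc Y, ∀ j ∈ Finset.range (k + 1), ∀ q ∈ Sq' Y a j, ∀ x ∈ SX' Y a j q,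
      X0 Y a j q x ⊆ Y.1 ∧ IsTDom (X0 Y a j q x))
    (hn : ∀ Y, ∀ a ∈ Sc Y, ∀ j ∈ Finset.range (k + 1), ∀ q ∈ Sq' Y a j, ∀ x ∈ SX' Y a j q,
      (Y.1 \ X0 Y a j q x).card ≤ n Y a j q x)
    (h126' : ∀ Y, ∀ a ∈ Sc Y, ∀ j ∈ Finset.range (k + 1), ∀ q ∈ Sq' Y a j,
      ∑ x ∈ SX' Y a j q, Real.exp (-(c.δ * c.κ * dj' Y a j q x)) ≤ O1')
    (hq' : ∀ Y, ∀ a ∈ Sc Y, ∀ j ∈ Finset.range (k + 1),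
      ∑ q ∈ Sq' Y a j, Real.exp (-((1 / 2) * c.δ₀ * dist Y a j q)) ≤ O₂)
    (hSc : ∀ Y, (Sc Y).card ≤ Y.1.card)
    (hC : K * O1 * (2 * (6 * (c.L : ℝ)) ^ 4) * Real.exp 1 * Real.exp ((1 / 8) * c.κ₁ * d0) +
        2 * (64 * K') * O1' * O₂ ≤
      c.E₀ * c.ε₁ * c.C₁ * c.M ^ c.q * Real.exp (c.C₂ * c.κ₁)) :
    B13.Lemma1Printed W.toStepData c := by
  -- the (I.3.7)-type sum: analyticity and the torus bound of §2
  have hAn₂ : ∀ Y, W.Analytic (∑ a ∈ Sc Y, ∑ j ∈ Finset.range (k + 1), ∑ q ∈ Sq' Y a j, ∑ x ∈ SX' Y a j q,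
      T' Y a j q x) (W.sp1 Y) := by
    intro Y
    refine analytic_finset_sum W.Analytic (W.sp1 Y) (hAdd _) (hZero _) _ _ fun a ha => ?_
    refine analytic_finset_sum W.Analytic (W.sp1 Y) (hAdd _) (hZero _) _ _ fun j hj => ?_
    refine analytic_finset_sum W.Analytic (W.sp1 Y) (hAdd _) (hZero _) _ _ fun q hq'' => ?_
    exact analytic_finset_sum W.Analytic (W.sp1 Y) (hAdd _) (hZero _) _ _ fun x hx => hAnT' Y a ha j hj q hq'' x hx
  have h129' := boundP9_twoTorus W c Sc k Sq' SX' T' dist dj' X0 n hK' hO1' hO₂ hL hκ hδ1 hR8 hδ₀M hδκ h130 hdj'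
    h131 hX0 hn h126' hq' hSc
  exact lemma1Printed_twoTorus W c S0 blk F k Sq SX T dj N _ h133 hAdd hZero hAnT hAn₂ hK hO1 hd0 hL hκ₁ hκ₁' h124
    hblk hNblk hN hF hS0 h126 hq h129' hR9 hC

end Torus

end Literature.MathematicalPhysics.QuantumFieldTheory.Balaban1983to89.B13Lemma1TorusFull
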